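import Mathlib
import Summits.Ventures.HodgeRepro2.T5BallCharacters

/-!
# Self-duality of a complete discretely valued field: every continuous character is a shift of one
  non-trivial continuous character — the local-field half of (A1′)

`K` a field with `Valued K ℤᵐ⁰`, COMPLETE, whose balls have finite index in each other and whose
valuation attains every `exp j`; `ψ : AddChar K Circle` continuous and non-trivial.  Then for every
continuous `χ : AddChar K Circle` there is a UNIQUE `t ∈ K` with `χ = ψ(t·)`:

* `exists_conductor`: a continuous non-trivial `ψ` has an exact conductor `c` (trivial on `B c`,
  not on `B (c+1)`) — `Int.exists_greatest_of_bdd` on the set of `k` with `ψ` trivial on `B k`;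
* `exists_forall_eq_mulShift` (EXISTENCE): `χ` is trivial on some `B b` (`T5ValuedBallBasis`); the
  finite-quotient self-duality (`T5BallCharacters`) gives `t_n` with `χ = ψ(t_n·)` on `B (b+n)`;
  the `t_n` are unique modulo `B (c − b − n)`, hence Cauchy; `K` complete ⇒ `t_n → t`, and
  `χ x = ψ(t_n x) → ψ(t x)`;
* `eq_of_forall_mulShift_eq` (UNIQUENESS): `ψ(t·) = ψ(t'·)` ⇒ `t = t'`.

The printed sentence (N5.12.6 (A1′)): «the characters of `E_v` trivial on `F_v` are `x ↦ ψ₀(tx)`,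
`t ∈ F_v` … Pontryagin dual of `F_v = {ψ(t·)}`» — the second clause is this file (for Mathlib's
`adicCompletion` the hypotheses are discharged in `T5AdicCompletionSelfDuality`).

Declaration per README §8(d): «uses an L-value-free non-vanishing device: NO».
-/

namespace Summit.Ventures.HodgeRepro2.T5LocalSelfDuality

open WithZero T5ValuedBallBasis T5BallCharacters Filter Topology

variable {K : Type*} [Field K] [Valued K ℤᵐ⁰]

/-- A continuous non-trivial character has an exact conductor. -/
theorem exists_conductor (ψ : AddChar K Circle) (hψc : Continuous ψ) (hψ : ψ ≠ 1) :
    ∃ c : ℤ, (∀ x : K, Valued.v x ≤ exp c → ψ x = 1) ∧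
      ∃ y : K, Valued.v y ≤ exp (c + 1) ∧ ψ y ≠ 1 := by
  obtain ⟨k₀, hk₀⟩ := (continuous_iff_exists_forall_le_exp_eq_one ψ).1 hψc
  -- a point where `ψ ≠ 1`, and a ball containing it
  have hne : ∃ y : K, ψ y ≠ 1 := by
    by_contra h
    exact hψ (AddChar.ext ψ 1 fun y => by
      rw [AddChar.one_apply]
      exact by_contra fun h' => h ⟨y, h'⟩)
  obtain ⟨y, hy⟩ := hne
  have hy0 : y ≠ 0 := by
    rintro rfl
    exact hy (AddChar.map_zero_eq_one ψ)
  have hvy : Valued.v y ≠ 0 := by simpa using hy0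
  set j := (Valued.v y).log with hj
  have hyj : Valued.v y = exp j := (exp_log hvy).symm
  -- the set of good `k` is bounded above by `j - 1`
  obtain ⟨c, hc, hmax⟩ := Int.exists_greatest_of_bdd
    (P := fun k : ℤ => ∀ x : K, Valued.v x ≤ exp k → ψ x = 1) ⟨j - 1, fun z hz => by
      by_contra hlt
      rw [not_le] at hlt
      exact hy (hz y (by rw [hyj]; exact exp_le_exp.2 (by omega)))⟩ ⟨k₀, hk₀⟩
  refine ⟨c, hc, ?_⟩
  by_contra h
  have h' : ∀ x : K, Valued.v x ≤ exp (c + 1) → ψ x = 1 := fun x hx =>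
    by_contra fun h'' => h ⟨x, hx, h''⟩
  have := hmax (c + 1) h'
  omega

/-- Every `x` lies in some ball `B (b + n)`. -/
theorem exists_nat_val_le (b : ℤ) (x : K) : ∃ n : ℕ, Valued.v x ≤ exp (b + n) := by
  by_cases hx : x = 0
  · exact ⟨0, by simp [hx]⟩
  · have hvx : Valued.v x ≠ 0 := by simpa using hx
    obtain ⟨j, hj⟩ : ∃ j : ℤ, Valued.v x = exp j := ⟨_, (exp_log hvx).symm⟩
    refine ⟨(j - b).toNat, ?_⟩
    rw [hj, exp_le_exp]
    have := Int.self_le_toNat (j - b)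
    omega

/-- EXISTENCE: every continuous character is a shift of `ψ`. -/
theorem exists_forall_eq_mulShift [CompleteSpace K]
    (hfin : ∀ a b : ℤ, b ≤ a → (ball (K := K) b).relIndex (ball a) ≠ 0)
    (hval : ∀ j : ℤ, ∃ u : K, Valued.v u = exp j)
    (ψ : AddChar K Circle) (hψc : Continuous ψ) (hψ : ψ ≠ 1)
    (χ : AddChar K Circle) (hχc : Continuous χ) :
    ∃ t : K, ∀ x : K, χ x = ψ (t * x) := by
  obtain ⟨c, hψ1, hψ2⟩ := exists_conductor ψ hψc hψ
  obtain ⟨b, hb⟩ := (continuous_iff_exists_forall_le_exp_eq_one χ).1 hχc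
  -- the approximating shifts `t n` on `B (b + n)`
  have happrox : ∀ n : ℕ, ∃ t : K, Valued.v t ≤ exp (c - b) ∧
      ∀ x : K, Valued.v x ≤ exp (b + n) → χ x = ψ (t * x) := fun n =>
    exists_val_le_forall_eq_mulShift ψ hψ1 hψ2 hfin hval (by omega) χ hb
  choose t ht using happrox
  -- uniqueness modulo `B (c - b - n)`: `ψ ((t m - t n) x) = 1` on `B (b + n)` for `n ≤ m`
  have hdiff : ∀ n m : ℕ, n ≤ m → Valued.v (t m - t n) ≤ exp (c - (b + n)) := by
    intro n m hnm
    apply val_le_of_forall_mulShift_eq_one ψ hψ2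
    intro x hx
    have hxm : Valued.v x ≤ exp (b + m) := le_trans hx (exp_le_exp.2 (by omega))
    rw [sub_mul, AddChar.map_sub_eq_div, ← (ht m).2 x hxm, ← (ht n).2 x hx, div_self']
  -- Cauchy
  have hcauchy : CauchySeq t := by
    rw [cauchySeq_iff]
    intro V hV
    rw [uniformity_eq_comap_nhds_zero K, mem_comap] at hV
    obtain ⟨s, hs, hsV⟩ := hV
    obtain ⟨k, hk⟩ := exists_forall_le_exp_mem_of_mem_nhds_zero hs
    refine ⟨(c - b - k).toNat, fun l hl m hm => hsV ?_⟩
    show t m - t l ∈ s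
    apply hk
    rcases le_total l m with hlm | hml
    · exact le_trans (hdiff l m hlm) (exp_le_exp.2 (by
        have := Int.self_le_toNat (c - b - k); omega))
    · rw [← neg_sub, Valuation.map_neg]
      exact le_trans (hdiff m l hml) (exp_le_exp.2 (by
        have := Int.self_le_toNat (c - b - k); omega))
  obtain ⟨t₀, ht₀⟩ := cauchySeq_tendsto_of_complete hcauchy
  refine ⟨t₀, fun x => ?_⟩
  -- `χ x = ψ (t n * x)` for all large `n`, and `ψ (t n * x) → ψ (t₀ * x)`
  obtain ⟨n₀, hn₀⟩ := exists_nat_val_le b x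
  have hlim : Tendsto (fun n => ψ (t n * x)) atTop (𝓝 (ψ (t₀ * x))) :=
    (hψc.tendsto _).comp (ht₀.mul_const x)
  have hconst : Tendsto (fun n => ψ (t n * x)) atTop (𝓝 (χ x)) := by
    refine tendsto_const_nhds.congr' ?_
    rw [EventuallyEq, eventually_atTop]
    exact ⟨n₀, fun n hn => (ht n).2 x (le_trans hn₀ (exp_le_exp.2 (by omega)))⟩
  exact tendsto_nhds_unique hconst hlim

/-- UNIQUENESS: `ψ(t·) = ψ(t'·)` forces `t = t'`. -/
theorem eq_of_forall_mulShift_eq (ψ : AddChar K Circle) (hψc : Continuous ψ) (hψ : ψ ≠ 1)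
    {t t' : K} (h : ∀ x : K, ψ (t * x) = ψ (t' * x)) : t = t' := by
  obtain ⟨c, _, hψ2⟩ := exists_conductor ψ hψc hψ
  have hall : ∀ m : ℤ, Valued.v (t - t') ≤ exp (c - m) := fun m =>
    val_le_of_forall_mulShift_eq_one ψ hψ2 fun x _ => by
      rw [sub_mul, AddChar.map_sub_eq_div, h x, div_self']
  by_contra hne
  have hne' : t - t' ≠ 0 := sub_ne_zero.2 hne
  have hv : Valued.v (t - t') ≠ 0 := by simpa using hne'
  obtain ⟨j, hj⟩ : ∃ j : ℤ, Valued.v (t - t') = exp j := ⟨_, (exp_log hv).symm⟩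
  have := hall (c - j + 1)
  rw [hj, exp_le_exp] at this
  omega

end Summit.Ventures.HodgeRepro2.T5LocalSelfDuality
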